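import Literature.MathematicalPhysics.QuantumFieldTheory.Balaban1983to89.B7Eq123General
import Literature.MathematicalPhysics.QuantumFieldTheory.Balaban1983to89.B7Prop6GeneralLevels

/-!
# `Balaban1983to89.B7Prop6GeneralAnalytic` — T. Bałaban, *Averaging operations for lattice gauge theories*, Commun. Math. Phys.
**98** (1985) 17–51 [Balaban1985Averaging]: the ANALYTICITY CLAUSES of Proposition 4 (p. 38) and Proposition 6 (p. 43)
AT A GENERAL BACKGROUND `U₀`, k-uniform, unconditional

statement-level skeleton of published theorems with citation tags; proofs where landed; nothing here is a claim about the Yang–Mills mass gap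

PDF held: `paper:balaban1985-cmp98-averaging` (journal page = PDF page + 16); renders `…/1985-cmp98-averaging-p022-x2.png` (p. 38),
`p026/p027-x2.png` (pp. 42–43), read as images by the unit.

CITATION HEADER (lean-in-tree rule).  Cell `lit-balaban` (HOME `run/shared/lean/pub/lit-balaban/`), unit `lit-balaban-r04` (B7
reader/typer, gen 3; TAKING line HOME/STATUS.md 2026-08-21T03:49:45Z) — KERNEL PIECES for the FIRST clauses of SKELETON rows
`B7.Prop4` ("`Q_k(U₀, ηA, c)` … is an analytic function of `A_b`") and `B7.Prop6` ("`\overline{U′U₀}ᵏ` is an analytic function of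
`A′`") at a general background; the second clauses ((130)/(131)/(134)/(135), resp. (164)) are `B7Eq123General.prop4_general` (seat
p06) and `B7Prop6GeneralLevels.prop6_general_unconditional`.  The flat twins (`U₀ = 1`) are `B7Prop4Flat.prop4_flat_analyticAt` and
`B7Prop6Flat.prop6_flat_analyticAt` / `prop6_flat_analyticOnNhd_ins`, whose architecture this file mirrors line by line.

PRINT.  p. 38: "**Proposition 4.** There exist constants C₂, c₄ > 0, … such that for α₀, α₁ ≦ c₄ the function
`Q_k(U₀, ηA, c) = (1/i) log(U̿₁ᵏ)_c`, `c ∈ Ω^{(k)}`, is an analytic function of `A_b`, `b ⊂ Bᵏ(c₋) ∪ Bᵏ(c₊)`, and [(134)–(135)]";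
p. 37: "(1/i) log U̿₁ᵏ as a function of (1/i) log U₁ is a composition of the functions … (127)"; p. 42: "Proposition 4 implies
that the functions of A in (159) are analytic functions …"; p. 43: "**Proposition 6.** If `U₀` satisfies (52), then `\overline{U′U₀}ᵏ`
is an analytic function of `A′ = (1/(iη)) log U′` for `A′` with values in the complexified algebra, and satisfying `|A′| < α₁`, and
we have the estimate (164) for α₀, α₁ sufficiently small."

WHAT THIS FILE PROVES (kernel, no `sorry`, standard axioms; hypotheses = those of `B7Eq123General.prop4_general` at the base
point `t₀` of a bondwise-analytic parametrisation `B(t)`, `t` in any complex normed space `E`).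
* §1 **`prop4_general_analyticAt`** — Prop. 4's analyticity clause @gen: every composite (127) `t ↦ Q_j(U₀, ηB(t))(c)`
  (`logCovIter L U₀ (B t) j z κ`), `j ≤ k`, is analytic at `t₀`.  Induction on `j` = print's "composition of the functions (127)":
  the one-step map is analytic at the level background `Ū₀ʲ` (`B7Prop3GeneralAnalytic.prop3_general_analyticAt_of_le_c3`, Prop. 3)
  on the domain supplied by (131) (`sup‖Q_j‖ ≤ 2Lʲb ≤ c₃`, `B7Eq123General.prop4_general`) and by the regularity of `Ū₀ʲ`
  (`B7Eq123General.level_data` / `blockLoops_of_pdev`, Prop. 2 / Prop. 1).  §1b `prop4_general_analyticOnNhd_ins`: the GENUINE object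
  `(1/i) log U̿₁ᵏ(c)` as a function on `𝔸^S` (finitely many bond variables inserted, `B7Prop3Flat.insCfg`) is analytic on a
  neighbourhood of every point of an open polydisc `{∀ b ∈ S, ‖A_b‖ < ρ}` with `ρ` below the Prop.-4 thresholds (`k ≥ 1`).
* §2 **`vcovQ`**, **`vcov_eq_vcovQ`**, **`analyticAt_vcovQ`** — the accumulated covariant frames (97)/(160) `v_j` written through
  the composites, `w_{j+1}(z) = w_j(Lz)·\overline{R̄ʲ_{0,Lz} e^{Q_j}}` (general-background twin of `B7Prop6Flat.vprodQ`; `= vcov` under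
  `U̿′ʲ = e^{Q_j}`), analytic in `t` together with their inverses (`B7Prop3GeneralAnalytic.analyticAt_wframe_expCfg`).
* §3 **`avgQG`**, **`avgIter_eq_avgQG`**, **`prop6_general_analyticAt`** — the right side of (159) `w_k(c₋)·e^{Q_k(c)}·Ū₀ᵏ(c)·w_k(c₊)⁻¹`
  as a composite (twin of `B7Prop6Flat.avgQ`), equal to `Ūᵏ(c) = avgIter L (e^{B}U₀) k c` under the Prop.-4 smallness, analytic at `t₀`.
* §4 **`prop6_general_analyticOnNhd_ins`**, **`prop6_general_ins`** — PROPOSITION 6 AT A GENERAL BACKGROUND IN THE PRINTED LETTER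
  on `𝔸^S`: `a ↦ Ūᵏ(c)[e^{insCfg S a}U₀]` is analytic on a neighbourhood of every point of the open polydisc `{∀ b ∈ S, ‖a_b‖ < ρ}`
  for any `ρ > 0` with `e^{4cα₀}(1 + 8C₁Lᵏρ) ≤ 2`, `2Lᵏρ ≤ c₃(d,L)`, and (164) `‖Ūᵏ(c)Ū₀ᵏ(c)⁻¹ − 1‖ ≤ 200(d+1)Lᵏ‖a‖_∞` on the
  closed polydisc.
* §5 `vcovQ_one_left`, `avgQG_one_left` — at `U₀ = 1` the new composites ARE the flat ones of `B7Prop6Flat`.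
READINGS (as in the lineage): `U1`/Banach-algebra carrier; global sup bounds on `ℤᵈ` with `η` absorbed (`b` plays `ηα₁`); print's
"A_b, b ⊂ Bᵏ(c₋) ∪ Bᵏ(c₊)" is the case `S ⊇` those bonds (locality is not re-proved here); thresholds displayed separately.
NOT CLAIMED: joint analyticity in `(A′, A)` (Proposition 7); (136).
DECLARATIONS: `vcovQ`, `avgQG` (defs with bodies) + theorems; imports `B7Eq123General`, `B7Prop6GeneralLevels`; REUSED BY NAME:
`B7Eq123General.prop4_general / level_data / levels_le_c3 / blockLoops_of_pdev / dbavgCovIter_eq_expCfg_logCovIter / norm_mlog_dbavgCovIter_le`,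
`B7Prop6GeneralLevels.eq164_general_unconditional`, `B7Prop3GeneralAnalytic.prop3_general_analyticAt_of_le_c3 / logDomainCov_lt /
analyticAt_wframe_expCfg`, `B7Eq92Concrete.vcov / vcov_succ / wframe / dbavgCovIter / val_avgIter_mul_eq`, `B7Prop4GeneralLevels.logCovIter`,
`B7Prop3GeneralLinear.Qcov`, `B7Prop3Flat.expCfg / insCfg / analyticAt_insCfg / norm_insCfg_le / c3`, `B7Prop4Flat.isOpen_polydisc`,
`B7Prop6Flat.vprodQ / avgQ`.
Unit `lit-balaban-r04` (gen 3), 2026-08-21.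

[cite: Balaban1985Averaging, Proposition 4 p.38, Proposition 6 p.43, (159)–(161) p.42, (127) p.37, (97) p.32]
-/

noncomputable section

open NormedSpace Finset

namespace Literature.MathematicalPhysics.QuantumFieldTheory.Balaban1983to89.B7Prop6GeneralAnalytic

open B7Prop1Explicit B7Prop2Explicit B7Prop3Flat MatrixLog B7Eq92Concrete B7Prop3GeneralAnalytic B7Prop3GeneralLinear
  B7Prop4GeneralLevels B7Prop6GeneralLevels

-- `Site` alone would resolve to the torus sites of `Setup.lean`; re-export the `ℤ^d` sites of `B7Prop1Explicit`.
export B7Prop1Explicit (Site)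

variable {d : ℕ}

variable {𝔸 : Type*} [NormedRing 𝔸] [NormedAlgebra ℂ 𝔸] [CompleteSpace 𝔸] [NormOneClass 𝔸]
variable {E : Type*} [NormedAddCommGroup E] [NormedSpace ℂ E]

/-- print's threshold in the `θ`-currency of `B7Prop3GeneralAnalytic`: `a ≤ c₃(d, L) = 1/(128(d+1)L)` gives `(2d+2)L·a ≤ 1/64`.
[cite: Balaban1985Averaging, Proposition 3 p.36] -/
private theorem theta_le_of_le_c3 {L : ℕ} (hL : 1 ≤ L) {a : ℝ} (hac : a ≤ c3 d L) :
    ((2 * (d * L) + L + L : ℕ) : ℝ) * a ≤ 1 / 64 := by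
  have hL1 : (1 : ℝ) ≤ L := by exact_mod_cast hL
  have hcast : ((2 * (d * L) + L + L : ℕ) : ℝ) = 2 * ((d : ℝ) + 1) * L := by push_cast; ring
  rw [hcast]
  have hpos : (0 : ℝ) < 128 * ((d : ℝ) + 1) * L := by positivity
  have h1 : a * (128 * ((d : ℝ) + 1) * L) ≤ 1 := by
    have := mul_le_mul_of_nonneg_right hac hpos.le
    rwa [c3, one_div, inv_mul_cancel₀ hpos.ne'] at this
  nlinarith

/-! ## §1 Proposition 4, the analyticity clause, at a general background -/

/-- **PROPOSITION 4, THE ANALYTICITY CLAUSE, AT A GENERAL REGULAR BACKGROUND, k-UNIFORM, UNCONDITIONAL** (p. 38: "the function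
`Q_k(U₀, ηA, c) = (1/i) log(U̿₁ᵏ)_c` … is an analytic function of `A_b`"; p. 37: "a composition of the functions (127)"), parametrised
form: under the hypotheses of `B7Eq123General.prop4_general` at the base point — `L ≥ 2`; `U₀` `G`-valued (`AvgClosed`), (52)
`pdev U₀ < α₀L^{−2k}`, `C₀α₀ ≤ ⅓`, `4α₀ ≤ c₂′(d,L)`; `sup‖B(t₀)‖ ≤ b`; `e^{4cα₀}(1 + 8C₁Lᵏb) ≤ 2` (`c = 800(d+1)²(d+4)`,
`C₁ = 131072(d+1)²`), `2Lᵏb ≤ c₃(d,L)` — and for `B(t)` bondwise analytic at `t₀` (`t` in any complex normed space `E`), every composite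
(127) `t ↦ Q_j(U₀, ηB(t))(c) = logCovIter L U₀ (B t) j c`, `j ≤ k`, is analytic at `t₀` at every bond `c`.  Induction on `j`: the one-step
map `A ↦ Q(Ū₀ʲ, A, c)` is analytic (`B7Prop3GeneralAnalytic.prop3_general_analyticAt_of_le_c3`, Proposition 3 at the level background)
at arguments of sup norm `≤ 2Lʲb ≤ c₃` ((131) at `t₀`, `B7Eq123General.prop4_general`), the level background being unit-bounded with
regular block loops (`B7Eq123General.level_data`, `blockLoops_of_pdev`). [cite: Balaban1985Averaging, Proposition 4 p.38, (127) p.37, (131) p.38] -/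
theorem prop4_general_analyticAt (L : ℕ) (hL : 2 ≤ L) {G : Subgroup 𝔸ˣ} (hG : AvgClosed d L G) (k : ℕ)
    (U₀ : Site d → Fin d → 𝔸ˣ) (hU₀ : ∀ x κ, U₀ x κ ∈ G) {α₀ : ℝ} (hα : 0 < α₀)
    (hα3 : C0 d * α₀ ≤ 1 / 3) (hα4 : 4 * α₀ ≤ c2' d L) (h52 : pdev U₀ < α₀ * (((L : ℝ) ^ k)⁻¹) ^ 2)
    (B : E → Site d → Fin d → 𝔸) {t₀ : E} (hBa : ∀ x κ, AnalyticAt ℂ (fun t => B t x κ) t₀)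
    {b : ℝ} (hb : 0 ≤ b) (hB : ∀ x κ, ‖B t₀ x κ‖ ≤ b)
    (hsmall : Real.exp (4 * (800 * ((d : ℝ) + 1) ^ 2 * ((d : ℝ) + 4)) * α₀)
      * (1 + 8 * (131072 * ((d : ℝ) + 1) ^ 2) * ((L : ℝ) ^ k * b)) ≤ 2)
    (hc₃ : 2 * ((L : ℝ) ^ k * b) ≤ c3 d L) :
    ∀ j ≤ k, ∀ (z : Site d) (κ : Fin d), AnalyticAt ℂ (fun t => logCovIter L U₀ (B t) j z κ) t₀ := by
  have hL1 : 1 ≤ L := le_trans (by norm_num) hL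
  have h4 := B7Eq123General.prop4_general L hL hG k U₀ hU₀ hα hα3 hα4 h52 (B t₀) hb hB hsmall hc₃
  have hlev := B7Eq123General.level_data L hL hG k U₀ hU₀ hα hα3 hα4 h52
  have hc₃' := B7Eq123General.levels_le_c3 hL1 hb hc₃
  intro j
  induction j with
  | zero => intro _ z κ; simpa only [logCovIter_zero] using hBa z κ
  | succ j ih =>
    intro hjk z κ
    have hj : j < k := Nat.lt_of_succ_le hjk
    obtain ⟨hV₀, hβ0, hβ, hβmax⟩ := hlev j hj.le
    have hA : ∀ x κ', ‖logCovIter L U₀ (B t₀) j x κ'‖ ≤ 2 * ((L : ℝ) ^ j * b) := (h4 j hj.le).2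
    obtain ⟨hreg, hα1⟩ := B7Eq123General.blockLoops_of_pdev hL1 hV₀ hβ0 hβ hβmax ((L : ℤ) • z) κ
    have h := prop3_general_analyticAt_of_le_c3 (fun t => logCovIter L U₀ (B t) j) (fun x κ' => ih hj.le x κ') hL1 hV₀
      (by positivity) hA (hc₃' j hj) ((L : ℤ) • z) κ hα1 hreg
    simpa only [logCovIter_succ, Qcov] using h

/-- the smallness hypotheses of `prop4_general` are monotone in `b` (used to pass from a polydisc radius `ρ` to `‖a‖ ≤ ρ`).
[folklore] -/
private theorem smallness_mono {L k : ℕ} {α₀ b ρ : ℝ} (hbρ : b ≤ ρ)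
    (hρsmall : Real.exp (4 * (800 * ((d : ℝ) + 1) ^ 2 * ((d : ℝ) + 4)) * α₀)
      * (1 + 8 * (131072 * ((d : ℝ) + 1) ^ 2) * ((L : ℝ) ^ k * ρ)) ≤ 2)
    (hρc₃ : 2 * ((L : ℝ) ^ k * ρ) ≤ c3 d L) :
    Real.exp (4 * (800 * ((d : ℝ) + 1) ^ 2 * ((d : ℝ) + 4)) * α₀)
        * (1 + 8 * (131072 * ((d : ℝ) + 1) ^ 2) * ((L : ℝ) ^ k * b)) ≤ 2 ∧
      2 * ((L : ℝ) ^ k * b) ≤ c3 d L := by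
  have hLk : (0 : ℝ) ≤ (L : ℝ) ^ k := by positivity
  have hm : (L : ℝ) ^ k * b ≤ (L : ℝ) ^ k * ρ := mul_le_mul_of_nonneg_left hbρ hLk
  refine ⟨?_, by linarith⟩
  have hexp : 0 ≤ Real.exp (4 * (800 * ((d : ℝ) + 1) ^ 2 * ((d : ℝ) + 4)) * α₀) := (Real.exp_pos _).le
  have h1 : 1 + 8 * (131072 * ((d : ℝ) + 1) ^ 2) * ((L : ℝ) ^ k * b)
      ≤ 1 + 8 * (131072 * ((d : ℝ) + 1) ^ 2) * ((L : ℝ) ^ k * ρ) := by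
    have : 0 ≤ 8 * (131072 * ((d : ℝ) + 1) ^ 2) := by positivity
    nlinarith
  exact (mul_le_mul_of_nonneg_left h1 hexp).trans hρsmall

/-- **PROPOSITION 4, THE ANALYTICITY CLAUSE FOR THE GENUINE OBJECT `(1/i) log U̿₁ᵏ(c)` IN THE PRINTED LETTER on `𝔸^S`, AT A
GENERAL BACKGROUND**: for every finite set `S` of bonds of the fine lattice, `k ≥ 1`, every bond `c = ⟨z, z + e_κ⟩` of `Ω^{(k)}`, and
every radius `ρ > 0` below the Prop.-4 thresholds (`e^{4cα₀}(1 + 8C₁Lᵏρ) ≤ 2`, `2Lᵏρ ≤ c₃(d,L)`; `U₀` as in `prop4_general`), the function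
`(A_b)_{b∈S} ↦ log U̿₁ᵏ(c)[U₁ = e^{A} on S, = 1 off S]` — `mlog (dbavgCovIter L U₀ (e^{insCfg S a}) k c)`, the logarithm (21) of the
`k`-th order covariant average (90)/(91) — is analytic on a neighbourhood of every point of the open polydisc `{∀ b ∈ S, ‖A_b‖ < ρ}`, on
which it coincides with the composite (127) (`B7Eq123General.norm_mlog_dbavgCovIter_le`).  (The unit `1/i` is immaterial.)
[cite: Balaban1985Averaging, Proposition 4 p.38, (127) p.37, (90)–(91) p.31] -/
theorem prop4_general_analyticOnNhd_ins (S : Finset (Site d × Fin d)) (L : ℕ) (hL : 2 ≤ L) {G : Subgroup 𝔸ˣ}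
    (hG : AvgClosed d L G) {k : ℕ} (hk : 1 ≤ k) (U₀ : Site d → Fin d → 𝔸ˣ) (hU₀ : ∀ x κ, U₀ x κ ∈ G) {α₀ : ℝ}
    (hα : 0 < α₀) (hα3 : C0 d * α₀ ≤ 1 / 3) (hα4 : 4 * α₀ ≤ c2' d L) (h52 : pdev U₀ < α₀ * (((L : ℝ) ^ k)⁻¹) ^ 2)
    {ρ : ℝ} (hρ : 0 < ρ)
    (hρsmall : Real.exp (4 * (800 * ((d : ℝ) + 1) ^ 2 * ((d : ℝ) + 4)) * α₀)
      * (1 + 8 * (131072 * ((d : ℝ) + 1) ^ 2) * ((L : ℝ) ^ k * ρ)) ≤ 2)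
    (hρc₃ : 2 * ((L : ℝ) ^ k * ρ) ≤ c3 d L) (z : Site d) (κ : Fin d) :
    AnalyticOnNhd ℂ (fun a : S → 𝔸 => mlog ((dbavgCovIter L U₀ (expCfg (insCfg S a)) k z κ : 𝔸ˣ) : 𝔸))
      {a | ∀ s, ‖a s‖ < ρ} := by
  obtain ⟨j, rfl⟩ : ∃ j, k = j + 1 := ⟨k - 1, (Nat.sub_add_cancel hk).symm⟩
  have hmodel : AnalyticOnNhd ℂ (fun a : S → 𝔸 => logCovIter L U₀ (insCfg S a) (j + 1) z κ) {a | ∀ s, ‖a s‖ < ρ} := by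
    intro a ha
    have hna : ‖a‖ < ρ := (pi_norm_lt_iff hρ).2 ha
    obtain ⟨hs, hc⟩ := smallness_mono (d := d) (L := L) (k := j + 1) (α₀ := α₀) hna.le hρsmall hρc₃
    exact prop4_general_analyticAt L hL hG (j + 1) U₀ hU₀ hα hα3 hα4 h52 (fun a' : S → 𝔸 => insCfg S a')
      (fun x κ' => analyticAt_insCfg S x κ' a) (norm_nonneg a) (fun x κ' => norm_insCfg_le S a x κ') hs hc
      (j + 1) le_rfl z κ
  refine hmodel.congr (B7Prop4Flat.isOpen_polydisc S _) fun a ha => ?_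
  have hna : ‖a‖ < ρ := (pi_norm_lt_iff hρ).2 ha
  obtain ⟨hs, hc⟩ := smallness_mono (d := d) (L := L) (k := j + 1) (α₀ := α₀) hna.le hρsmall hρc₃
  exact ((B7Eq123General.norm_mlog_dbavgCovIter_le L hL hG (j + 1) U₀ hU₀ hα hα3 hα4 h52 (insCfg S a) (norm_nonneg a)
    (fun x κ' => norm_insCfg_le S a x κ') hs hc le_rfl z κ).1).symm

/-! ## §2 The accumulated covariant frames through the composites -/

/-- **THE ACCUMULATED COVARIANT FRAMES (97)/(160) THROUGH THE COMPOSITES**: `w_0 = 1`, `w_{j+1}(z) = w_j(Lz)·\overline{R̄ʲ_{0,Lz}e^{Q_j}}`,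
the new factor being the block frame (82) `B7Eq92Concrete.wframe` of `e^{Q_j(U₀, ηB)}` at the background `Ū₀ʲ` — i.e. `B7Eq92Concrete.vcov`
with `U̿′ʲ` replaced by `e^{Q_j}` (they agree under the Prop.-4 smallness, `vcov_eq_vcovQ`); the general-background twin of
`B7Prop6Flat.vprodQ` (`vcovQ_one_left`), and the object whose analyticity is read off ("Proposition 4 implies that the functions of A in
(159) are analytic", p. 42). [cite: Balaban1985Averaging, (97) p.32, (160) p.42] -/
def vcovQ (L : ℕ) (U₀ : Site d → Fin d → 𝔸ˣ) (B : Site d → Fin d → 𝔸) : ℕ → Site d → 𝔸ˣ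
  | 0 => fun _ => 1
  | j + 1 => fun z => vcovQ L U₀ B j ((L : ℤ) • z) * wframe L (avgIter L U₀ j) (expCfg (logCovIter L U₀ B j)) ((L : ℤ) • z)

omit [NormOneClass 𝔸] in
/-- `vcovQ_zero`: `w_0 = 1`. [cite: Balaban1985Averaging, (97) p.32] -/
@[simp] theorem vcovQ_zero (L : ℕ) (U₀ : Site d → Fin d → 𝔸ˣ) (B : Site d → Fin d → 𝔸) (z : Site d) :
    vcovQ L U₀ B 0 z = 1 := rfl

omit [NormOneClass 𝔸] in
/-- `vcovQ_succ`: the recursion (97). [cite: Balaban1985Averaging, (97) p.32] -/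
theorem vcovQ_succ (L : ℕ) (U₀ : Site d → Fin d → 𝔸ˣ) (B : Site d → Fin d → 𝔸) (j : ℕ) (z : Site d) :
    vcovQ L U₀ B (j + 1) z
      = vcovQ L U₀ B j ((L : ℤ) • z) * wframe L (avgIter L U₀ j) (expCfg (logCovIter L U₀ B j)) ((L : ℤ) • z) := rfl

omit [NormOneClass 𝔸] in
/-- Whenever `U̿′ʲ = e^{Q_j}` bondwise for `j ≤ k` (`B7Eq123General.dbavgCovIter_eq_expCfg_logCovIter`), the two descriptions of the
frames agree: `v_j[e^{B}] = w_j(B)`, `j ≤ k`. [cite: Balaban1985Averaging, (160) p.42, (127) p.37] -/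
theorem vcov_eq_vcovQ (L : ℕ) (U₀ : Site d → Fin d → 𝔸ˣ) (B : Site d → Fin d → 𝔸) (k : ℕ)
    (hQ : ∀ j ≤ k, dbavgCovIter L U₀ (expCfg B) j = expCfg (logCovIter L U₀ B j)) :
    ∀ j ≤ k, vcov L U₀ (expCfg B) j = vcovQ L U₀ B j
  | 0, _ => rfl
  | j + 1, hj => by
    funext z
    rw [vcov_succ, vcovQ_succ, vcov_eq_vcovQ L U₀ B k hQ j (Nat.le_of_succ_le hj), hQ j (Nat.le_of_succ_le hj)]

/-- **The frames `w_j(B(t))(z)` and their inverses, `j ≤ k`, are analytic at `t₀`** under the hypotheses of `prop4_general_analyticAt`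
(finite products of the block frames `e^{±F}` (82) of `e^{Q_j(U₀, ηB(t))}` at `Ū₀ʲ`, analytic by `B7Prop3GeneralAnalytic.analyticAt_wframe_expCfg`
on the domain supplied by (131) and the regularity of `Ū₀ʲ` — `B7Prop3GeneralAnalytic.logDomainCov_lt`; `κ` is any direction, witnessing
`d ≥ 1`). [cite: Balaban1985Averaging, p.42 (after (163)), (160) p.42, (131) p.38] -/
theorem analyticAt_vcovQ (L : ℕ) (hL : 2 ≤ L) {G : Subgroup 𝔸ˣ} (hG : AvgClosed d L G) (k : ℕ)
    (U₀ : Site d → Fin d → 𝔸ˣ) (hU₀ : ∀ x κ, U₀ x κ ∈ G) {α₀ : ℝ} (hα : 0 < α₀)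
    (hα3 : C0 d * α₀ ≤ 1 / 3) (hα4 : 4 * α₀ ≤ c2' d L) (h52 : pdev U₀ < α₀ * (((L : ℝ) ^ k)⁻¹) ^ 2)
    (B : E → Site d → Fin d → 𝔸) {t₀ : E} (hBa : ∀ x κ, AnalyticAt ℂ (fun t => B t x κ) t₀)
    {b : ℝ} (hb : 0 ≤ b) (hB : ∀ x κ, ‖B t₀ x κ‖ ≤ b)
    (hsmall : Real.exp (4 * (800 * ((d : ℝ) + 1) ^ 2 * ((d : ℝ) + 4)) * α₀)
      * (1 + 8 * (131072 * ((d : ℝ) + 1) ^ 2) * ((L : ℝ) ^ k * b)) ≤ 2)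
    (hc₃ : 2 * ((L : ℝ) ^ k * b) ≤ c3 d L) (κ : Fin d) :
    ∀ j ≤ k, ∀ z : Site d, AnalyticAt ℂ (fun t => ((vcovQ L U₀ (B t) j z : 𝔸ˣ) : 𝔸)) t₀ ∧
      AnalyticAt ℂ (fun t => (((vcovQ L U₀ (B t) j z)⁻¹ : 𝔸ˣ) : 𝔸)) t₀ := by
  have hL1 : 1 ≤ L := le_trans (by norm_num) hL
  have h4 := B7Eq123General.prop4_general L hL hG k U₀ hU₀ hα hα3 hα4 h52 (B t₀) hb hB hsmall hc₃
  have hlev := B7Eq123General.level_data L hL hG k U₀ hU₀ hα hα3 hα4 h52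
  have hc₃' := B7Eq123General.levels_le_c3 hL1 hb hc₃
  have hQan := prop4_general_analyticAt L hL hG k U₀ hU₀ hα hα3 hα4 h52 B hBa hb hB hsmall hc₃
  intro j
  induction j with
  | zero =>
    intro _ z
    simp only [vcovQ_zero, inv_one, Units.val_one]
    exact ⟨analyticAt_const, analyticAt_const⟩
  | succ j ih =>
    intro hjk z
    have hj : j < k := Nat.lt_of_succ_le hjk
    obtain ⟨hV₀, hβ0, hβ, hβmax⟩ := hlev j hj.le
    have hA : ∀ x κ', ‖logCovIter L U₀ (B t₀) j x κ'‖ ≤ 2 * ((L : ℝ) ^ j * b) := (h4 j hj.le).2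
    obtain ⟨hreg, hα1⟩ := B7Eq123General.blockLoops_of_pdev hL1 hV₀ hβ0 hβ hβmax ((L : ℤ) • z) κ
    have hT := (logDomainCov_lt hL1 hV₀ (logCovIter L U₀ (B t₀) j) (by positivity) hA le_rfl (by positivity)
      (theta_le_of_le_c3 hL1 (hc₃' j hj)) ((L : ℤ) • z) κ hα1 hreg).2.1
    have hw := analyticAt_wframe_expCfg (fun t => logCovIter L U₀ (B t) j) (fun x κ' => hQan j hj.le x κ') L
      (avgIter L U₀ j) ((L : ℤ) • z) hT
    have ih' := ih hj.le ((L : ℤ) • z)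
    simp only [vcovQ_succ, Units.val_mul, mul_inv_rev]
    exact ⟨ih'.1.fun_mul hw.1, hw.2.fun_mul ih'.2⟩

/-! ## §3 The right side of (159) as a composite of analytic maps -/

/-- **The right side of (159) at a general background as a function of `A′`**: `Ũ′ᵏ(c)·Ū₀ᵏ(c) = w_k(c₋)·e^{Q_k(U₀, ηB)(c)}·Ū₀ᵏ(c)·w_k(c₊)⁻¹`
— the composite through which the analyticity of `Ūᵏ(c) = \overline{U′U₀}ᵏ(c)` is read off (general-background twin of `B7Prop6Flat.avgQ`,
`avgQG_one_left`). [cite: Balaban1985Averaging, (159) p.42] -/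
def avgQG (L : ℕ) (U₀ : Site d → Fin d → 𝔸ˣ) (B : Site d → Fin d → 𝔸) (k : ℕ) (z : Site d) (κ : Fin d) : 𝔸 :=
  (vcovQ L U₀ B k z : 𝔸) * exp (logCovIter L U₀ B k z κ) * (avgIter L U₀ k z κ : 𝔸)
    * (((vcovQ L U₀ B k (z + e κ))⁻¹ : 𝔸ˣ) : 𝔸)

/-- **Under the Prop.-4 smallness, `Ūᵏ(c)` IS the composite `avgQG`**: (159) (`B7Eq92Concrete.val_avgIter_mul_eq`) + `U̿′ᵏ = e^{Q_k}`
(`B7Eq123General.dbavgCovIter_eq_expCfg_logCovIter`) + `vcov_eq_vcovQ`; hypotheses of `B7Eq123General.prop4_general`.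
[cite: Balaban1985Averaging, (159) p.42, (127) p.37] -/
theorem avgIter_eq_avgQG (L : ℕ) (hL : 2 ≤ L) {G : Subgroup 𝔸ˣ} (hG : AvgClosed d L G) (k : ℕ)
    (U₀ : Site d → Fin d → 𝔸ˣ) (hU₀ : ∀ x κ, U₀ x κ ∈ G) {α₀ : ℝ} (hα : 0 < α₀)
    (hα3 : C0 d * α₀ ≤ 1 / 3) (hα4 : 4 * α₀ ≤ c2' d L) (h52 : pdev U₀ < α₀ * (((L : ℝ) ^ k)⁻¹) ^ 2)
    (B : Site d → Fin d → 𝔸) {b : ℝ} (hb : 0 ≤ b) (hB : ∀ x κ, ‖B x κ‖ ≤ b)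
    (hsmall : Real.exp (4 * (800 * ((d : ℝ) + 1) ^ 2 * ((d : ℝ) + 4)) * α₀)
      * (1 + 8 * (131072 * ((d : ℝ) + 1) ^ 2) * ((L : ℝ) ^ k * b)) ≤ 2)
    (hc₃ : 2 * ((L : ℝ) ^ k * b) ≤ c3 d L) (z : Site d) (κ : Fin d) :
    ((avgIter L (expCfg B * U₀) k z κ : 𝔸ˣ) : 𝔸) = avgQG L U₀ B k z κ := by
  have hQ := B7Eq123General.dbavgCovIter_eq_expCfg_logCovIter L hL hG k U₀ hU₀ hα hα3 hα4 h52 B hb hB hsmall hc₃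
  have hX : ((dbavgCovIter L U₀ (expCfg B) k z κ : 𝔸ˣ) : 𝔸) = exp (logCovIter L U₀ B k z κ) := by
    rw [hQ k le_rfl]; rfl
  rw [val_avgIter_mul_eq, hX, vcov_eq_vcovQ L U₀ B k hQ k le_rfl]
  rfl

/-- **PROPOSITION 6 AT A GENERAL BACKGROUND, THE ANALYTICITY CLAUSE, parametrised form** ("`\overline{U′U₀}ᵏ` is an analytic function of
`A′ = (1/(iη)) log U′` for `A′` with values in the complexified algebra, and satisfying `|A′| < α₁`"; proof p. 42: "Proposition 4 implies that
the functions of A in (159) are analytic"): for `B(t)` bondwise analytic at `t₀` and the hypotheses of `B7Eq123General.prop4_general` at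
`B(t₀)`, the composite (159) `t ↦ w_k(c₋)·e^{Q_k(U₀, ηB(t))(c)}·Ū₀ᵏ(c)·w_k(c₊)⁻¹` — which IS `Ūᵏ(c)[e^{B(t)}U₀]` wherever the smallness holds
(`avgIter_eq_avgQG`) — is analytic at `t₀`. [cite: Balaban1985Averaging, Proposition 6 p.43, p.42 (after (163))] -/
theorem prop6_general_analyticAt (L : ℕ) (hL : 2 ≤ L) {G : Subgroup 𝔸ˣ} (hG : AvgClosed d L G) (k : ℕ)
    (U₀ : Site d → Fin d → 𝔸ˣ) (hU₀ : ∀ x κ, U₀ x κ ∈ G) {α₀ : ℝ} (hα : 0 < α₀)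
    (hα3 : C0 d * α₀ ≤ 1 / 3) (hα4 : 4 * α₀ ≤ c2' d L) (h52 : pdev U₀ < α₀ * (((L : ℝ) ^ k)⁻¹) ^ 2)
    (B : E → Site d → Fin d → 𝔸) {t₀ : E} (hBa : ∀ x κ, AnalyticAt ℂ (fun t => B t x κ) t₀)
    {b : ℝ} (hb : 0 ≤ b) (hB : ∀ x κ, ‖B t₀ x κ‖ ≤ b)
    (hsmall : Real.exp (4 * (800 * ((d : ℝ) + 1) ^ 2 * ((d : ℝ) + 4)) * α₀)
      * (1 + 8 * (131072 * ((d : ℝ) + 1) ^ 2) * ((L : ℝ) ^ k * b)) ≤ 2)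
    (hc₃ : 2 * ((L : ℝ) ^ k * b) ≤ c3 d L) (z : Site d) (κ : Fin d) :
    AnalyticAt ℂ (fun t => avgQG L U₀ (B t) k z κ) t₀ := by
  have hv := analyticAt_vcovQ L hL hG k U₀ hU₀ hα hα3 hα4 h52 B hBa hb hB hsmall hc₃ κ k le_rfl
  have hQ := prop4_general_analyticAt L hL hG k U₀ hU₀ hα hα3 hα4 h52 B hBa hb hB hsmall hc₃ k le_rfl z κ
  unfold avgQG
  exact (((hv z).1.fun_mul ((exp_analytic _).fun_comp_of_eq hQ rfl)).fun_mul analyticAt_const).fun_mul (hv (z + e κ)).2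

/-! ## §4 Proposition 6 at a general background in the printed letter on `𝔸^S` -/

/-- **PROPOSITION 6 AT A GENERAL BACKGROUND, THE ANALYTICITY CLAUSE IN THE PRINTED LETTER on `𝔸^S`** (p. 43: "If `U₀` satisfies (52), then
`\overline{U′U₀}ᵏ` is an analytic function of `A′` … satisfying `|A′| < α₁` … for α₀, α₁ sufficiently small"): for every finite set `S` of bonds
of the fine lattice, every `k`, every bond `c = ⟨z, z + e_κ⟩` of `Ω^{(k)} ≅ ℤᵈ`, `U₀` `G`-valued with (52), `C₀α₀ ≤ ⅓`, `4α₀ ≤ c₂′(d,L)`, and every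
radius `ρ > 0` with `e^{4cα₀}(1 + 8C₁Lᵏρ) ≤ 2`, `2Lᵏρ ≤ c₃(d,L)` ("α₁ small": `ρ` plays `ηα₁`), the function `𝔸^S → 𝔸`,
`(A′_b)_{b∈S} ↦ Ūᵏ(c)` [`U′ = e^{A′}` on `S`, `U′ = 1` off `S`: `B7Prop3Flat.insCfg`; `Ūᵏ` the GENUINE `k`-fold average (43) of `U′U₀`] is
analytic on a neighbourhood of every point of the open polydisc `{∀ b ∈ S, ‖A′_b‖ < ρ}`; there it coincides with the composite (159)
(`avgIter_eq_avgQG`), analytic by `prop6_general_analyticAt`. [cite: Balaban1985Averaging, Proposition 6 p.43, (159) p.42] -/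
theorem prop6_general_analyticOnNhd_ins (S : Finset (Site d × Fin d)) (L : ℕ) (hL : 2 ≤ L) {G : Subgroup 𝔸ˣ}
    (hG : AvgClosed d L G) (k : ℕ) (U₀ : Site d → Fin d → 𝔸ˣ) (hU₀ : ∀ x κ, U₀ x κ ∈ G) {α₀ : ℝ}
    (hα : 0 < α₀) (hα3 : C0 d * α₀ ≤ 1 / 3) (hα4 : 4 * α₀ ≤ c2' d L) (h52 : pdev U₀ < α₀ * (((L : ℝ) ^ k)⁻¹) ^ 2)
    {ρ : ℝ} (hρ : 0 < ρ)
    (hρsmall : Real.exp (4 * (800 * ((d : ℝ) + 1) ^ 2 * ((d : ℝ) + 4)) * α₀)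
      * (1 + 8 * (131072 * ((d : ℝ) + 1) ^ 2) * ((L : ℝ) ^ k * ρ)) ≤ 2)
    (hρc₃ : 2 * ((L : ℝ) ^ k * ρ) ≤ c3 d L) (z : Site d) (κ : Fin d) :
    AnalyticOnNhd ℂ (fun a : S → 𝔸 => ((avgIter L (expCfg (insCfg S a) * U₀) k z κ : 𝔸ˣ) : 𝔸))
      {a | ∀ s, ‖a s‖ < ρ} := by
  have hmodel : AnalyticOnNhd ℂ (fun a : S → 𝔸 => avgQG L U₀ (insCfg S a) k z κ) {a | ∀ s, ‖a s‖ < ρ} := by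
    intro a ha
    have hna : ‖a‖ < ρ := (pi_norm_lt_iff hρ).2 ha
    obtain ⟨hs, hc⟩ := smallness_mono (d := d) (L := L) (k := k) (α₀ := α₀) hna.le hρsmall hρc₃
    exact prop6_general_analyticAt L hL hG k U₀ hU₀ hα hα3 hα4 h52 (fun a' : S → 𝔸 => insCfg S a')
      (fun x κ' => analyticAt_insCfg S x κ' a) (norm_nonneg a) (fun x κ' => norm_insCfg_le S a x κ') hs hc z κ
  refine hmodel.congr (B7Prop4Flat.isOpen_polydisc S _) fun a ha => ?_
  have hna : ‖a‖ < ρ := (pi_norm_lt_iff hρ).2 ha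
  obtain ⟨hs, hc⟩ := smallness_mono (d := d) (L := L) (k := k) (α₀ := α₀) hna.le hρsmall hρc₃
  exact (avgIter_eq_avgQG L hL hG k U₀ hU₀ hα hα3 hα4 h52 (insCfg S a) (norm_nonneg a)
    (fun x κ' => norm_insCfg_le S a x κ') hs hc z κ).symm

/-- **PROPOSITION 6 AT A GENERAL BACKGROUND on `𝔸^S`, the bound (164)** on the CLOSED polydisc `{∀ b ∈ S, ‖A′_b‖ ≤ ρ}` (same data):
`‖Ūᵏ(c)·Ū₀ᵏ(c)⁻¹ − 1‖ ≤ 200(d+1)·Lᵏ‖A′‖_∞` ("|\overline{U′U₀}ᵏ(Ūᵏ₀)⁻¹ − 1| < O(1)α₁", `‖A′‖_∞ = sup_{b∈S} ‖A′_b‖`;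
`B7Prop6GeneralLevels.eq164_general_unconditional`). [cite: Balaban1985Averaging, Proposition 6 (164) p.43] -/
theorem prop6_general_ins (S : Finset (Site d × Fin d)) (L : ℕ) (hL : 2 ≤ L) {G : Subgroup 𝔸ˣ}
    (hG : AvgClosed d L G) (k : ℕ) (U₀ : Site d → Fin d → 𝔸ˣ) (hU₀ : ∀ x κ, U₀ x κ ∈ G) {α₀ : ℝ}
    (hα : 0 < α₀) (hα3 : C0 d * α₀ ≤ 1 / 3) (hα4 : 4 * α₀ ≤ c2' d L) (h52 : pdev U₀ < α₀ * (((L : ℝ) ^ k)⁻¹) ^ 2)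
    {ρ : ℝ} (hρ : 0 ≤ ρ)
    (hρsmall : Real.exp (4 * (800 * ((d : ℝ) + 1) ^ 2 * ((d : ℝ) + 4)) * α₀)
      * (1 + 8 * (131072 * ((d : ℝ) + 1) ^ 2) * ((L : ℝ) ^ k * ρ)) ≤ 2)
    (hρc₃ : 2 * ((L : ℝ) ^ k * ρ) ≤ c3 d L) (z : Site d) (κ : Fin d) {a : S → 𝔸} (ha : ∀ s, ‖a s‖ ≤ ρ) :
    ‖((avgIter L (expCfg (insCfg S a) * U₀) k z κ : 𝔸ˣ) : 𝔸) * (((avgIter L U₀ k z κ)⁻¹ : 𝔸ˣ) : 𝔸) - 1‖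
      ≤ 200 * ((d : ℝ) + 1) * ((L : ℝ) ^ k * ‖a‖) := by
  have hna : ‖a‖ ≤ ρ := (pi_norm_le_iff_of_nonneg hρ).2 ha
  obtain ⟨hs, hc⟩ := smallness_mono (d := d) (L := L) (k := k) (α₀ := α₀) hna hρsmall hρc₃
  exact eq164_general_unconditional L hL hG k U₀ hU₀ hα hα3 hα4 h52 (insCfg S a) (norm_nonneg a)
    (fun x κ' => norm_insCfg_le S a x κ') hs hc z κ

/-! ## §5 At `U₀ = 1` the composites are the flat ones -/

omit [NormOneClass 𝔸] in
/-- At the flat background the composite frames are `B7Prop6Flat.vprodQ`: `w_j(1, B) = w_j(B)` (`Ū₀ʲ = 1`, `wframe L 1 = vframe L`,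
`Q_j(1, ·) = B7Prop4Flat.logIter`). [cite: Balaban1985Averaging, (160) p.42] -/
theorem vcovQ_one_left (L : ℕ) (B : Site d → Fin d → 𝔸) :
    ∀ j : ℕ, vcovQ L (1 : Site d → Fin d → 𝔸ˣ) B j = B7Prop6Flat.vprodQ L B j
  | 0 => rfl
  | j + 1 => by
    funext z
    rw [vcovQ_succ, B7Prop6Flat.vprodQ_succ, vcovQ_one_left L B j, avgIter_one, wframe_one_left, logCovIter_one_left]

omit [NormOneClass 𝔸] in
/-- At the flat background the composite (159) is `B7Prop6Flat.avgQ`. [cite: Balaban1985Averaging, (159) p.42] -/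
theorem avgQG_one_left (L : ℕ) (B : Site d → Fin d → 𝔸) (k : ℕ) (z : Site d) (κ : Fin d) :
    avgQG L (1 : Site d → Fin d → 𝔸ˣ) B k z κ = B7Prop6Flat.avgQ L B k z κ := by
  simp only [avgQG, B7Prop6Flat.avgQ, vcovQ_one_left, avgIter_one, logCovIter_one_left, Pi.one_apply, Units.val_one, mul_one]

end Literature.MathematicalPhysics.QuantumFieldTheory.Balaban1983to89.B7Prop6GeneralAnalytic

end
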